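import Literature.MathematicalPhysics.QuantumFieldTheory.Balaban1983to89.B1TorusCubeContours

/-!
# `Balaban1983to89.B1TorusSubBoxChart` — the DICTIONARY between a SUB-BOX «□_j = Ω ∩ {a sum of large blocks for which the point
# Mj is one of the vertices}» ([Balaban1983RegularityDecay] §2 p. 575) of a window cube of the (Higgs)₂,₃ torus `T_ε`
# ([Balaban1982Higgs1] (1.2)) and the box carrier `Π_μ[0, L^K·M_μ)` ⊂ ℤ^{d} of the cell's [B4] Lemma 2.2 lineage
# (`B4Lemma22ReduceZero.Box` with PER-DIRECTION sides `M_μ ≤ 2M`): sites, lattice steps, `K`-blocks, fields read on the box and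
# their sup norms, and the composite contours «Γ^{(k)}_{y,x}» of (2.2) as a contour SYSTEM on the sub-box

statement-level skeleton of published theorems with citation tags; proofs where landed; nothing here is a claim about the Yang–Mills mass gap

CITATION HEADER (lean-in-tree rule).  T. Bałaban, *(Higgs)₂,₃ quantum fields in a finite volume. I*, Commun. Math. Phys. **85**
(1982) 603–626 [Balaban1982Higgs1] ((1.2) p. 604 the torus, (1.17)–(1.20) p. 607 the blocks, (2.1)–(2.2) p. 608 the contours, (2.20)
p. 610 the operator, Prop. 2.1 p. 610 and the sentence p. 611 l.1–2 «For some simple sets Ω, e.g. for rectangular parallelepipeds, the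
inequalities hold without any restrictions on the points x, x′») and T. Bałaban, *Regularity and decay of lattice Green's functions*,
Commun. Math. Phys. **89** (1983) 571–597 [Balaban1983RegularityDecay] (§2 p. 575 «□_j = Ω ∩ {…}», p. 579 «if Ω is a rectangular
parallelepiped, then all □_j in the representation (2.13) are cubes and we can apply Lemma 2.2 to all operators in it», p. 584 the box
«□ = {x ∈ ξZ^d : 0 ≤ x_μ ≤ M_μ}»).  PDF held: `paper:balaban1983-cmp89-regularity-decay` (journal page = PDF page + 570; p. 575 = `p0005.txt`,
p. 579 = `p0009.txt`, re-read by this seat), `paper:balaban1982-cmp85-higgs23-i` (p. 611 = `p0009.txt`).  Cell `lit-balaban` (HOME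
`run/shared/lean/pub/lit-balaban/`), Phase-2 proof seat **p35** gen 15 (unit `lit-balaban-p35`); SKELETON rows **B1.Prop2.1** / **B1.Eq2.25**
(the parallelepiped clause of Prop. 2.1 on the (Higgs)₂,₃ carrier: the sub-box chart feeding the no-collar Lemma 2.2 of
`B4Lemma22BoxNoCollar` into the torus random walk) and **B4.Thm@573** / **B4.Lem2.2** (dictionary).  USED BY NAME, never restated: gen 8's
`B1TorusCubeCover.{half, nLab, Lab, cube, chart}`, `B1TorusCubeChart.{dd, castD, vecT, toT, fromT, M2, nK, mem_box_iff, toT_fromT, fromT_toT_of_mem,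
mem_cube_iff, toT_add_e1, toT_sub_e1, toT_injOn, blockIter_toT_eq_iff, mem_cube_of_blockIter_eq}`, `B1TorusCubeContours.{clv, mlist, mem_mlist_bounds,
pathEnd_mlist, pathRel_mlist, length_mlist_le, lsum_mlist_eq_multiContourSum, lsum_pmap, one_le_n}`, the typer's `HiggsLattice`/`HiggsAveraging`,
b04's `B4Reflection242.{boxDom, blk, nbrs}`, r01's `B4Lower18Regular.{e1, baseEmb, PathRel, lsum, mem_boxDom_of_between, val_pathEnd_pmap,
pathRel_pmap_iff}`, `B4Lemma22ReduceZero.Box`, `B4Lemma21Region.siteNorm`, `B4Lemma22Reduce231.supN`.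

WHAT IS PRINTED.  [B4] p. 575 [PDF 5] L9–12, verbatim: *«□_j = Ω ∩ {a sum of large blocks for which the point Mj is one of the vertices}.
Let us observe that if the point Mj is not a boundary point of Ω, then □_j is a cube of the size 2M and with center in Mj. For Mj lying
on the boundary the set □_j is a sum of several (< 2d) large blocks.»*; p. 579 [PDF 9] L25–28, verbatim: *«Finally let us notice that if
Ω is a rectangular parallelepiped, then all □_j in the representation (2.13) are cubes and we can apply Lemma 2.2 to all operators in
it, so the restriction dist({x, x′}, Ωᶜ) ≧ R₀ is unnecessary.»*  (v1.1, p35 gen 17, docstrings only: the p. 575 sentences re-set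
verbatim from the text layer `p0005.txt` L9–12 and the render `1983-cmp89-regularity-decay-p005-x2.png` — v1.0 read «Hence if … with a
center in the point Mj», a paraphrase inside guillemets, ref-4 S-B1-g54-1 (c); no declaration changed.)
READING FORMALISED HERE: for a region `Ω` that is a product of unions of large blocks, every piece `Ω ∩ □_j` is — in the box coordinates of
SOME window label `j′` — a box `Π_i[0, L^K·M_i)` with `M_i ∈ {K₀, 2K₀}` large blocks (`K₀` = the print's `M` in unit blocks); this file is
the chart of such sub-boxes (the region geometry itself is `B1Ineq225RegularBox`).

WHAT THIS FILE PROVES (kernel-checked, zero `sorry`; definitions with bodies + theorems; no `def … : Prop` fact).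
* §1 `box_mono`, `mem_boxB_iff`, `box_subset_M2` (the sub-boxes `Box (dd P) (L−1) K Mb`, `Mb_i ≤ 2K₀`, inside gen 8's cube box).
* §2 `boxT K K₀ j Mb` (THE TORUS SUB-BOX: the sites of `□_j` whose box coordinates lie in `Π[0, L^K Mb_i)`): `mem_boxT_iff`,
  `boxT_subset_cube`, `toT_mem_boxT`, `eq_toT_fromT`, `add_e1_mem_boxB_iff` / `sub_e1_mem_boxB_iff` (no wrap-around, `3M ≤ |T_ε|_μ`).
* §3 `K`-BLOCKS: `mem_box_of_blk_eq` (a sub-box is a union of `blk`-classes), `mem_boxT_of_blockIter_eq` / `boxT_blockSat` (the torus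
  sub-box is a union of `K`-blocks — the shape hypothesis of r14's region lemmas).
* §4 FIELDS: `pullB` (a torus field read on the sub-box), `pullB_add/smul/hsmul`, `fld_pullB`, `siteNorm_pullB`, `supN_pullB_le`,
  `norm_le_supN_pullB` / `norm_eq_supN_pullB` (for `boxT`-supported fields the sup norms agree).
* §5 CONTOURS: `mlist_mem_boxB` (the composite contour (2.2) of a sub-box point stays in the sub-box), the contour SYSTEM `gammaB P K Mb`
  (`baseEmb` start, `mlist` body when `x ∈ B(y)`, else empty): `gammaB_end`, `gammaB_nn`, `length_gammaB_le`, `length_gammaB_le_real`,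
  **`lsum_gammaB`** (`A(Γ^{(K)}_{y,x})` on the sub-box = B1's `multiContourSum` along the chart).
HONEST SCOPE.  Bookkeeping only; hypotheses `K ≤ K_P`, `K₀ ∣ M_P`, `K₀ ≥ 8` (so `M ≥ 2`), `3·M ≤ |T_ε|_μ`, `Mb_i ≤ 2K₀`.  Unit `lit-balaban-p35`
gen 15 (literature-prover-lit-balaban-p35-g15-0).
-/

open scoped BigOperators

noncomputable section

namespace Literature.MathematicalPhysics.QuantumFieldTheory.Balaban1983to89.B1TorusSubBoxChart

open Literature.MathematicalPhysics.QuantumFieldTheory.Balaban1983to89.HiggsLattice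
open Literature.MathematicalPhysics.QuantumFieldTheory.Balaban1983to89.HiggsAveraging
open Literature.MathematicalPhysics.QuantumFieldTheory.Balaban1983to89.B1TorusCubeCover
open Literature.MathematicalPhysics.QuantumFieldTheory.Balaban1983to89.B1TorusCubeChart
open Literature.MathematicalPhysics.QuantumFieldTheory.Balaban1983to89.B1TorusCubeContours
open Literature.MathematicalPhysics.QuantumFieldTheory.Balaban1983to89.B4GaugeCovariance (fld fld_apply pathEnd)
open Literature.MathematicalPhysics.QuantumFieldTheory.Balaban1983to89.B4Reflection242 (boxDom mem_boxDom blk nbrs)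
open Literature.MathematicalPhysics.QuantumFieldTheory.Balaban1983to89.B4Lower18Regular (e1 e1_apply_self e1_apply_ne lsum PathRel
  baseEmb mem_boxDom_of_between val_pathEnd_pmap pathRel_pmap_iff)
open Literature.MathematicalPhysics.QuantumFieldTheory.Balaban1983to89.B4Lemma21Region (siteNorm)
open Literature.MathematicalPhysics.QuantumFieldTheory.Balaban1983to89.B4Lemma22Reduce231 (supN le_supN supN_le supN_nonneg
  siteNorm_nonneg)
open Literature.MathematicalPhysics.QuantumFieldTheory.Balaban1983to89.B4Lemma22ReduceZero (Box)

variable {P : HiggsLattice.Params} {N : ℕ}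

/-- `K₀ ≥ 8 ⇒ K₀ ≥ 1`. [folklore] -/
private theorem one_le_of_eight_le {K₀ : ℕ} (hK₀8 : 8 ≤ K₀) : 1 ≤ K₀ := le_trans (by norm_num) hK₀8

/-- `K₀ ≥ 8 ⇒ M = L^K·K₀ ≥ 2`. [folklore] -/
private theorem two_le_half_of_eight_le {K K₀ : ℕ} (hK₀8 : 8 ≤ K₀) : 2 ≤ half P K K₀ := by
  unfold half
  have : 1 ≤ P.L ^ K := Nat.one_le_pow _ _ P.hL
  nlinarith

/-! ## §1 The sub-boxes `Π_i[0, L^K·M_i)`, `M_i ≤ 2K₀`, of the cube box -/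

section SubBox

variable {K K₀ : ℕ}

/-- Boxes are monotone in their sides. [cite: Balaban1983RegularityDecay, p.584] -/
theorem box_mono {Mb Mb' : Fin (dd P + 1) → ℕ} (h : ∀ i, Mb i ≤ Mb' i) :
    Box (dd P) (P.L - 1) K Mb ⊆ Box (dd P) (P.L - 1) K Mb' := by
  intro y hy
  rw [mem_boxDom] at hy ⊢
  intro i
  refine ⟨(hy i).1, lt_of_lt_of_le (hy i).2 ?_⟩
  exact_mod_cast Nat.mul_le_mul_left _ (h i)

/-- Membership in the sub-box `Π_i[0, L^K·M_i)`. [cite: Balaban1983RegularityDecay, p.584] -/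
theorem mem_boxB_iff (Mb : Fin (dd P + 1) → ℕ) (y : Fin (dd P + 1) → ℤ) :
    y ∈ Box (dd P) (P.L - 1) K Mb ↔ ∀ i, 0 ≤ y i ∧ y i < (P.L : ℤ) ^ K * Mb i := by
  rw [mem_boxDom]
  simp only [predL_succ]
  push_cast
  exact Iff.rfl

/-- A sub-box with `M_i ≤ 2K₀` lies in gen 8's cube box `Π[0, L^K·2K₀)`. [cite: Balaban1983RegularityDecay, §2 p.575] -/
theorem box_subset_M2 {Mb : Fin (dd P + 1) → ℕ} (hMb : ∀ i, Mb i ≤ 2 * K₀) :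
    Box (dd P) (P.L - 1) K Mb ⊆ Box (dd P) (P.L - 1) K (M2 P K₀) :=
  box_mono fun i => by unfold M2; exact hMb i

end SubBox

/-! ## §2 The torus sub-box `boxT j Mb ⊂ □_j` -/

section TorusBox

variable (K K₀ : ℕ)

/-- **THE TORUS SUB-BOX**: the sites of the window `□_j` whose box coordinates lie in `Π_i[0, L^K·M_i)` — a union of large blocks with
the vertex `Mj − M` of `□_j`. [cite: Balaban1983RegularityDecay, §2 p.575] -/
def boxT (j : Lab P K K₀) (Mb : Fin (dd P + 1) → ℕ) : Finset (HiggsLattice.Site P 0) :=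
  Finset.univ.filter fun x => fromT K K₀ j x ∈ Box (dd P) (P.L - 1) K Mb

variable {K K₀}

/-- Membership in the torus sub-box. [cite: Balaban1983RegularityDecay, §2 p.575] -/
theorem mem_boxT_iff {j : Lab P K K₀} {Mb : Fin (dd P + 1) → ℕ} {x : HiggsLattice.Site P 0} :
    x ∈ boxT K K₀ j Mb ↔ fromT K K₀ j x ∈ Box (dd P) (P.L - 1) K Mb := by
  unfold boxT; rw [Finset.mem_filter]; simp

/-- The torus sub-box lies in the window cube. [cite: Balaban1983RegularityDecay, §2 p.575] -/
theorem boxT_subset_cube (hK : K ≤ P.K) (hK₀ : K₀ ∣ P.M) (hK₀8 : 8 ≤ K₀) (j : Lab P K K₀) {Mb : Fin (dd P + 1) → ℕ}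
    (hMb : ∀ i, Mb i ≤ 2 * K₀) : boxT K K₀ j Mb ⊆ cube K K₀ j := fun x hx =>
  (mem_cube_iff hK hK₀ (one_le_of_eight_le hK₀8) j x).2 (box_subset_M2 hMb (mem_boxT_iff.1 hx))

/-- Box points map into the torus sub-box. [cite: Balaban1983RegularityDecay, §2 p.575] -/
theorem toT_mem_boxT (hK : K ≤ P.K) (hK₀ : K₀ ∣ P.M) (hK₀8 : 8 ≤ K₀) (j : Lab P K K₀) {Mb : Fin (dd P + 1) → ℕ}
    (hMb : ∀ i, Mb i ≤ 2 * K₀) {y : Fin (dd P + 1) → ℤ} (hy : y ∈ Box (dd P) (P.L - 1) K Mb) :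
    toT K K₀ j y ∈ boxT K K₀ j Mb := by
  rw [mem_boxT_iff, fromT_toT_of_mem hK hK₀ (one_le_of_eight_le hK₀8) j (box_subset_M2 hMb hy)]
  exact hy

/-- Every torus site is the chart point of its box coordinates. [cite: Balaban1983RegularityDecay, §2 p.575] -/
theorem eq_toT_fromT (j : Lab P K K₀) (x : HiggsLattice.Site P 0) : x = toT K K₀ j (fromT K K₀ j x) := (toT_fromT j x).symm

/-- A sub-box point has chart coordinates in `[−1, 2M]`. [cite: Balaban1983RegularityDecay, §2 p.575] -/
private theorem bounds_of_mem {Mb : Fin (dd P + 1) → ℕ} (hMb : ∀ i, Mb i ≤ 2 * K₀) {y : Fin (dd P + 1) → ℤ}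
    (hy : y ∈ Box (dd P) (P.L - 1) K Mb) : ∀ i, -1 ≤ y i ∧ y i ≤ 2 * half P K K₀ := by
  have hy2 := (mem_box_iff y).1 (box_subset_M2 hMb hy)
  exact fun i => ⟨by linarith [(hy2 i).1], (hy2 i).2.le⟩

/-- **No wrap-around**: for `y` in the sub-box, `y + e_i` is in the sub-box iff `toT y + εe_i ∈ boxT` (`3M ≤ |T_ε|_μ`).
[cite: Balaban1983RegularityDecay, §2 p.575] -/
theorem add_e1_mem_boxB_iff (hK : K ≤ P.K) (hK₀ : K₀ ∣ P.M) (hK₀8 : 8 ≤ K₀)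
    (hN3 : ∀ μ, 3 * half P K K₀ ≤ P.sitesPerDir 0 μ) (j : Lab P K K₀) {Mb : Fin (dd P + 1) → ℕ} (hMb : ∀ i, Mb i ≤ 2 * K₀)
    {y : Fin (dd P + 1) → ℤ} (hy : y ∈ Box (dd P) (P.L - 1) K Mb) (i : Fin (dd P + 1)) :
    y + e1 i ∈ Box (dd P) (P.L - 1) K Mb ↔ (toT K K₀ j y).shift (castD P i) ∈ boxT K K₀ j Mb := by
  have hK₀' := one_le_of_eight_le hK₀8
  have hh2 : 2 ≤ half P K K₀ := two_le_half_of_eight_le hK₀8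
  rw [← toT_add_e1]
  constructor
  · exact toT_mem_boxT hK hK₀ hK₀8 j hMb
  · intro h
    rw [mem_boxT_iff] at h
    have e : toT K K₀ j (fromT K K₀ j (toT K K₀ j (y + e1 i))) = toT K K₀ j (y + e1 i) := toT_fromT j _
    have hyb := bounds_of_mem (K := K) hMb hy
    have hyy := toT_injOn hN3 hh2 j (y := fromT K K₀ j (toT K K₀ j (y + e1 i))) (y' := y + e1 i)
      (bounds_of_mem (K := K) hMb h) (fun i' => ?_) e
    · rw [← hyy]; exact h
    · rw [Pi.add_apply]
      by_cases hi : i' = i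
      · subst hi; rw [e1_apply_self]; constructor <;> linarith [(hyb i').1, (hyb i').2, ((mem_box_iff y).1
          (box_subset_M2 hMb hy) i').2]
      · rw [e1_apply_ne hi]; constructor <;> linarith [(hyb i').1, (hyb i').2]

/-- **No wrap-around**: for `y` in the sub-box, `y − e_i` is in the sub-box iff `toT y − εe_i ∈ boxT` (`3M ≤ |T_ε|_μ`).
[cite: Balaban1983RegularityDecay, §2 p.575] -/
theorem sub_e1_mem_boxB_iff (hK : K ≤ P.K) (hK₀ : K₀ ∣ P.M) (hK₀8 : 8 ≤ K₀)
    (hN3 : ∀ μ, 3 * half P K K₀ ≤ P.sitesPerDir 0 μ) (j : Lab P K K₀) {Mb : Fin (dd P + 1) → ℕ} (hMb : ∀ i, Mb i ≤ 2 * K₀)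
    {y : Fin (dd P + 1) → ℤ} (hy : y ∈ Box (dd P) (P.L - 1) K Mb) (i : Fin (dd P + 1)) :
    y - e1 i ∈ Box (dd P) (P.L - 1) K Mb ↔ (toT K K₀ j y).unshift (castD P i) ∈ boxT K K₀ j Mb := by
  have hK₀' := one_le_of_eight_le hK₀8
  have hh2 : 2 ≤ half P K K₀ := two_le_half_of_eight_le hK₀8
  rw [← toT_sub_e1]
  constructor
  · exact toT_mem_boxT hK hK₀ hK₀8 j hMb
  · intro h
    rw [mem_boxT_iff] at h
    have e : toT K K₀ j (fromT K K₀ j (toT K K₀ j (y - e1 i))) = toT K K₀ j (y - e1 i) := toT_fromT j _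
    have hyb := bounds_of_mem (K := K) hMb hy
    have hyy := toT_injOn hN3 hh2 j (y := fromT K K₀ j (toT K K₀ j (y - e1 i))) (y' := y - e1 i)
      (bounds_of_mem (K := K) hMb h) (fun i' => ?_) e
    · rw [← hyy]; exact h
    · rw [Pi.sub_apply]
      by_cases hi : i' = i
      · subst hi; rw [e1_apply_self]
        have := ((mem_box_iff y).1 (box_subset_M2 hMb hy) i').1
        constructor <;> linarith [(hyb i').2]
      · rw [e1_apply_ne hi]; constructor <;> linarith [(hyb i').1, (hyb i').2]

end TorusBox

/-! ## §3 `K`-blocks: the sub-box is a union of blocks -/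

section Blocks

variable {K K₀ : ℕ}

/-- **A SUB-BOX IS A UNION OF `blk`-CLASSES**: `y ∈ Π[0, L^KM_i)`, `blk_{L^K} y′ = blk_{L^K} y` ⇒ `y′ ∈ Π[0, L^KM_i)`.
[cite: Balaban1982Higgs1, (1.20) p.607] -/
theorem mem_box_of_blk_eq {Mb : Fin (dd P + 1) → ℕ} {y y' : Fin (dd P + 1) → ℤ} (hy : y ∈ Box (dd P) (P.L - 1) K Mb)
    (h : blk (nK P K) y' = blk (nK P K) y) : y' ∈ Box (dd P) (P.L - 1) K Mb := by
  rw [mem_boxB_iff] at hy ⊢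
  have hL : (0 : ℤ) < (P.L : ℤ) ^ K := by have := P.hL; positivity
  intro i
  have e : y' i / (P.L : ℤ) ^ K = y i / (P.L : ℤ) ^ K := by
    have := congrFun h i
    simp only [blk, nK] at this
    push_cast at this
    exact this
  obtain ⟨h0, h1⟩ := hy i
  -- `0 ≤ ⌊y/L^K⌋ = ⌊y'/L^K⌋ < Mb i`
  have hq0 : 0 ≤ y i / (P.L : ℤ) ^ K := Int.ediv_nonneg h0 hL.le
  have hq1 : y i / (P.L : ℤ) ^ K < Mb i := by rw [Int.ediv_lt_iff_lt_mul hL]; linarith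
  constructor
  · by_contra hneg
    rw [not_le] at hneg
    have : y' i / (P.L : ℤ) ^ K < 0 := Int.ediv_neg_of_neg_of_pos hneg hL
    omega
  · have hlt : y' i / (P.L : ℤ) ^ K < Mb i := by rw [e]; exact hq1
    have := Int.lt_mul_ediv_self_add (x := y' i) hL
    have h3 : (P.L : ℤ) ^ K * (y' i / (P.L : ℤ) ^ K) + (P.L : ℤ) ^ K ≤ (P.L : ℤ) ^ K * Mb i := by
      have : y' i / (P.L : ℤ) ^ K + 1 ≤ Mb i := hlt
      nlinarith
    linarith

/-- **THE TORUS SUB-BOX IS A UNION OF `K`-BLOCKS**: a torus site in the `K`-block of a point of `boxT` lies in `boxT`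
(`3M ≤ |T_ε|_μ`). [cite: Balaban1983RegularityDecay, §2 p.575] [cite: Balaban1982Higgs1, (1.20) p.607] -/
theorem mem_boxT_of_blockIter_eq (hK : K ≤ P.K) (hK₀ : K₀ ∣ P.M) (hK₀8 : 8 ≤ K₀)
    (hN3 : ∀ μ, 3 * half P K K₀ ≤ P.sitesPerDir 0 μ) (j : Lab P K K₀) {Mb : Fin (dd P + 1) → ℕ} (hMb : ∀ i, Mb i ≤ 2 * K₀)
    {x x' : HiggsLattice.Site P 0} (hx : x ∈ boxT K K₀ j Mb) (h : blockIter K x' = blockIter K x) : x' ∈ boxT K K₀ j Mb := by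
  have hK₀' := one_le_of_eight_le hK₀8
  have hxc : x ∈ cube K K₀ j := boxT_subset_cube hK hK₀ hK₀8 j hMb hx
  have hx'c : x' ∈ cube K K₀ j := mem_cube_of_blockIter_eq hK hK₀ hK₀' hN3 j hxc h
  have hy := (mem_cube_iff hK hK₀ hK₀' j x).1 hxc
  have hy' := (mem_cube_iff hK hK₀ hK₀' j x').1 hx'c
  have hb : blk (nK P K) (fromT K K₀ j x') = blk (nK P K) (fromT K K₀ j x) :=
    (blockIter_toT_eq_iff hK hN3 j hy' hy).1 (by rw [toT_fromT, toT_fromT]; exact h)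
  rw [mem_boxT_iff] at hx ⊢
  exact mem_box_of_blk_eq hx hb

/-- The shape hypothesis of r14's region lemmas for the torus sub-box: membership in `boxT` depends on the `K`-block only.
[cite: Balaban1983RegularityDecay, §2 p.575] -/
theorem boxT_blockSat (hK : K ≤ P.K) (hK₀ : K₀ ∣ P.M) (hK₀8 : 8 ≤ K₀)
    (hN3 : ∀ μ, 3 * half P K K₀ ≤ P.sitesPerDir 0 μ) (j : Lab P K K₀) {Mb : Fin (dd P + 1) → ℕ} (hMb : ∀ i, Mb i ≤ 2 * K₀) :
    ∀ x x' : HiggsLattice.Site P 0, blockIter K x = blockIter K x' → (x ∈ boxT K K₀ j Mb ↔ x' ∈ boxT K K₀ j Mb) :=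
  fun _ _ h => ⟨fun hx => mem_boxT_of_blockIter_eq hK hK₀ hK₀8 hN3 j hMb hx h.symm,
    fun hx' => mem_boxT_of_blockIter_eq hK hK₀ hK₀8 hN3 j hMb hx' h⟩

/-- Same torus block ⇔ same box block, for sub-box points. [cite: Balaban1982Higgs1, (1.20) p.607] -/
theorem blockIter_toT_eq_iff_sub (hK : K ≤ P.K) (hN3 : ∀ μ, 3 * half P K K₀ ≤ P.sitesPerDir 0 μ) (j : Lab P K K₀)
    {Mb : Fin (dd P + 1) → ℕ} (hMb : ∀ i, Mb i ≤ 2 * K₀) {y y' : Fin (dd P + 1) → ℤ} (hy : y ∈ Box (dd P) (P.L - 1) K Mb)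
    (hy' : y' ∈ Box (dd P) (P.L - 1) K Mb) :
    blockIter K (toT K K₀ j y) = blockIter K (toT K K₀ j y') ↔ blk (nK P K) y = blk (nK P K) y' :=
  blockIter_toT_eq_iff hK hN3 j (box_subset_M2 hMb hy) (box_subset_M2 hMb hy')

end Blocks

/-! ## §4 Fields: a torus field read on the sub-box; sup norms -/

section Fields

variable (K K₀ : ℕ)

/-- A field on `T_ε` READ ON THE SUB-BOX: `(pullB ψ)(y, i) = ψ(toT y)_i`. [cite: Balaban1983RegularityDecay, §2 p.575] -/
def pullB (j : Lab P K K₀) (Mb : Fin (dd P + 1) → ℕ) (ψ : HiggsLattice.ScalarField P 0 N) :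
    ↥(Box (dd P) (P.L - 1) K Mb) × Fin N → ℝ :=
  fun p => ψ (toT K K₀ j p.1.1) p.2

variable {K K₀}

/-- `pullB` is additive. [cite: Balaban1983RegularityDecay, §2 p.575] -/
theorem pullB_add (j : Lab P K K₀) (Mb : Fin (dd P + 1) → ℕ) (ψ φ : HiggsLattice.ScalarField P 0 N) :
    pullB K K₀ j Mb (ψ + φ) = pullB K K₀ j Mb ψ + pullB K K₀ j Mb φ := by
  funext p; simp [pullB]

/-- `pullB` is homogeneous. [cite: Balaban1983RegularityDecay, §2 p.575] -/
theorem pullB_smul (j : Lab P K K₀) (Mb : Fin (dd P + 1) → ℕ) (c : ℝ) (ψ : HiggsLattice.ScalarField P 0 N) :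
    pullB K K₀ j Mb (c • ψ) = c • pullB K K₀ j Mb ψ := by
  funext p; simp [pullB]

/-- `pullB` of a difference. [cite: Balaban1983RegularityDecay, §2 p.575] -/
theorem pullB_sub (j : Lab P K K₀) (Mb : Fin (dd P + 1) → ℕ) (ψ φ : HiggsLattice.ScalarField P 0 N) :
    pullB K K₀ j Mb (ψ - φ) = pullB K K₀ j Mb ψ - pullB K K₀ j Mb φ := by
  funext p; simp [pullB]

/-- `pullB` of a sitewise product `h·ψ`. [cite: Balaban1983RegularityDecay, (2.9) p.576] -/
theorem pullB_hsmul (j : Lab P K K₀) (Mb : Fin (dd P + 1) → ℕ) (h : HiggsLattice.Site P 0 → ℝ) (ψ : HiggsLattice.ScalarField P 0 N)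
    (p) : pullB K K₀ j Mb (h • ψ) p = h (toT K K₀ j p.1.1) * pullB K K₀ j Mb ψ p := by
  simp [pullB]

/-- The colour vector of `pullB ψ` at `y` is `ψ(toT y)`. [cite: Balaban1983RegularityDecay, §2 p.575] -/
theorem fld_pullB (j : Lab P K K₀) (Mb : Fin (dd P + 1) → ℕ) (ψ : HiggsLattice.ScalarField P 0 N)
    (y : ↥(Box (dd P) (P.L - 1) K Mb)) : fld (pullB K K₀ j Mb ψ) y = fun i => ψ (toT K K₀ j y.1) i := rfl

/-- `fld (pullB φ) z` is the coordinate vector of `φ(toT z)`. [cite: Balaban1983RegularityDecay, §2 p.575] -/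
theorem fld_pullB_ofLp (j : Lab P K K₀) (Mb : Fin (dd P + 1) → ℕ) (φ : HiggsLattice.ScalarField P 0 N)
    (z : ↥(Box (dd P) (P.L - 1) K Mb)) : fld (pullB K K₀ j Mb φ) z = WithLp.ofLp (φ (toT K K₀ j z.1)) := rfl

/-- The site norm of `pullB ψ` at `y` is the Euclidean norm `|ψ(toT y)|`. [cite: Balaban1982Higgs1, (1.5) p.604] -/
theorem siteNorm_pullB (j : Lab P K K₀) (Mb : Fin (dd P + 1) → ℕ) (ψ : HiggsLattice.ScalarField P 0 N)
    (y : ↥(Box (dd P) (P.L - 1) K Mb)) : siteNorm (fld (pullB K K₀ j Mb ψ) y) = ‖ψ (toT K K₀ j y.1)‖ := by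
  rw [siteNorm, EuclideanSpace.norm_eq, fld_pullB]
  congr 1
  simp only [dotProduct, Real.norm_eq_abs, sq, abs_mul_abs_self]

/-- `‖pullB ψ‖_∞ ≤ ‖ψ‖_∞`. [cite: Balaban1983RegularityDecay, (2.17) p.578] -/
theorem supN_pullB_le (j : Lab P K K₀) (Mb : Fin (dd P + 1) → ℕ) (ψ : HiggsLattice.ScalarField P 0 N) :
    supN (pullB K K₀ j Mb ψ) ≤ ‖ψ‖ :=
  supN_le (norm_nonneg _) fun y => by rw [siteNorm_pullB]; exact norm_le_pi_norm ψ _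

/-- For a `boxT`-supported field `‖ψ‖_∞ ≤ ‖pullB ψ‖_∞` (hence `=`). [cite: Balaban1983RegularityDecay, (2.17) p.578] -/
theorem norm_le_supN_pullB (j : Lab P K K₀) (Mb : Fin (dd P + 1) → ℕ) {ψ : HiggsLattice.ScalarField P 0 N}
    (hψ : ∀ x, x ∉ boxT K K₀ j Mb → ψ x = 0) : ‖ψ‖ ≤ supN (pullB K K₀ j Mb ψ) := by
  refine (pi_norm_le_iff_of_nonneg (supN_nonneg _)).2 fun x => ?_
  by_cases hx : x ∈ boxT K K₀ j Mb
  · have hy := mem_boxT_iff.1 hx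
    have h := le_supN (pullB K K₀ j Mb ψ) ⟨fromT K K₀ j x, hy⟩
    rw [siteNorm_pullB] at h
    simpa only [toT_fromT] using h
  · rw [hψ x hx, norm_zero]; exact supN_nonneg _

/-- For a `boxT`-supported field the two sup norms agree. [cite: Balaban1983RegularityDecay, (2.17) p.578] -/
theorem norm_eq_supN_pullB (j : Lab P K K₀) (Mb : Fin (dd P + 1) → ℕ) {ψ : HiggsLattice.ScalarField P 0 N}
    (hψ : ∀ x, x ∉ boxT K K₀ j Mb → ψ x = 0) : ‖ψ‖ = supN (pullB K K₀ j Mb ψ) :=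
  le_antisymm (norm_le_supN_pullB j Mb hψ) (supN_pullB_le j Mb ψ)

end Fields

/-! ## §5 The composite contours (2.2) as a contour system on the sub-box -/

section System

variable {K K₀ : ℕ}

/-- For `x` in the sub-box every site of `Γ^{(K)}_{·,x}` lies in the sub-box (the contour stays between the `K`-block corner of `x`
and `x`). [cite: Balaban1982Higgs1, (2.2) p.608] -/
theorem mlist_mem_boxB {Mb : Fin (dd P + 1) → ℕ} {x : Fin (dd P + 1) → ℤ} (hx : x ∈ Box (dd P) (P.L - 1) K Mb) :
    ∀ z ∈ mlist P.L K x, z ∈ Box (dd P) (P.L - 1) K Mb := by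
  intro z hz
  have hb := mem_mlist_bounds P.hL x K z hz
  have hx' := mem_boxDom.1 hx
  refine mem_boxDom_of_between (u := clv P.L K x) ?_ hx hb.1 hb.2
  rw [mem_boxDom]
  intro i
  exact ⟨clv_nonneg P.hL K (fun i => (hx' i).1) i, lt_of_le_of_lt (clv_le P.hL K x i) (hx' i).2⟩

open Classical in
/-- **THE CONTOUR SYSTEM `Γ^{(K)}_{y,x}` ON THE SUB-BOX**: the composite contour (2.2) when `x ∈ B^K(y)`, empty otherwise (start point
the block corner `baseEmb y = L^K·y`). [cite: Balaban1982Higgs1, (2.2) p.608] [cite: Balaban1983RegularityDecay, (1.4) p.572] -/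
def gammaB (P : HiggsLattice.Params) (K : ℕ) (Mb : Fin (dd P + 1) → ℕ) (y : ↥(boxDom Mb))
    (x : ↥(Box (dd P) (P.L - 1) K Mb)) : List ↥(Box (dd P) (P.L - 1) K Mb) :=
  if blk (nK P K) x.1 = y.1 then (mlist P.L K x.1).pmap Subtype.mk (mlist_mem_boxB x.2) else []

/-- When `x ∈ B^K(y)` the block corner `L^K·y` is `clv K x`. [cite: Balaban1982Higgs1, (2.2) p.608] -/
theorem baseEmb_eq_clv_sub {Mb : Fin (dd P + 1) → ℕ} {y : ↥(boxDom Mb)} {x : ↥(Box (dd P) (P.L - 1) K Mb)}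
    (h : blk (nK P K) x.1 = y.1) : (baseEmb (one_le_n P K) Mb y).1 = clv P.L K x.1 := by
  funext i
  have := congrFun h i
  simp only [blk] at this
  show (((P.L - 1 + 1) ^ K : ℕ) : ℤ) * y.1 i = (P.L : ℤ) ^ K * (x.1 i / (P.L : ℤ) ^ K)
  rw [← this, predL_succ]; push_cast; rfl

/-- The base point as the subtype element at `clv K x`. [cite: Balaban1982Higgs1, (2.2) p.608] -/
private theorem baseEmb_eq_mk {Mb : Fin (dd P + 1) → ℕ} {y : ↥(boxDom Mb)} {x : ↥(Box (dd P) (P.L - 1) K Mb)}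
    (h : blk (nK P K) x.1 = y.1) :
    baseEmb (one_le_n P K) Mb y = ⟨clv P.L K x.1, by rw [← baseEmb_eq_clv_sub h]; exact (baseEmb _ _ y).2⟩ :=
  Subtype.ext (baseEmb_eq_clv_sub h)

/-- **hend**: `Γ^{(K)}_{y,x}` ends at `x`. [cite: Balaban1982Higgs1, (2.2) p.608] -/
theorem gammaB_end {Mb : Fin (dd P + 1) → ℕ} (y : ↥(boxDom Mb)) (x : ↥(Box (dd P) (P.L - 1) K Mb))
    (h : blk (nK P K) x.1 = y.1) : pathEnd (baseEmb (one_le_n P K) Mb y) (gammaB P K Mb y x) = x := by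
  unfold gammaB
  rw [if_pos h]
  apply Subtype.ext
  rw [baseEmb_eq_mk h, val_pathEnd_pmap, pathEnd_mlist P.hL]

/-- **hend** in the form of the lineage (`blkWt ≠ 0 ⇒ x ∈ B(y)`). [cite: Balaban1982Higgs1, (2.2) p.608] -/
theorem gammaB_hend {Mb : Fin (dd P + 1) → ℕ} (y : ↥(boxDom Mb)) (x : ↥(Box (dd P) (P.L - 1) K Mb))
    (h : B4GaugeCovariance.blkWt ((P.L - 1 + 1) ^ K) Mb (fun i => (P.L - 1 + 1) ^ K * Mb i) y x ≠ 0) :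
    pathEnd (baseEmb (one_le_n P K) Mb y) (gammaB P K Mb y x) = x := by
  have hb := B4Lower18Regular.blkWt_ne_zero h
  have e : ∀ z : Fin (dd P + 1) → ℤ, blk ((P.L - 1 + 1) ^ K) z = blk (nK P K) z := fun z => by rw [predL_succ]
  rw [e] at hb
  exact gammaB_end y x hb

/-- **hnn**: `Γ^{(K)}_{y,x}` is a nearest-neighbour path. [cite: Balaban1982Higgs1, (2.2) p.608] -/
theorem gammaB_nn {Mb : Fin (dd P + 1) → ℕ} (y : ↥(boxDom Mb)) (x : ↥(Box (dd P) (P.L - 1) K Mb)) :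
    PathRel (fun u v : ↥(Box (dd P) (P.L - 1) K Mb) => v.1 ∈ nbrs u.1) (baseEmb (one_le_n P K) Mb y) (gammaB P K Mb y x) := by
  unfold gammaB
  by_cases h : blk (nK P K) x.1 = y.1
  · rw [if_pos h, baseEmb_eq_mk h]
    exact (pathRel_pmap_iff (r := fun a b : Fin (dd P + 1) → ℤ => b ∈ nbrs a) (mlist P.L K x.1) (clv P.L K x.1)
      _ _).2 (pathRel_mlist P.hL x.1 K)
  · rw [if_neg h]; trivial

/-- The length of `Γ^{(K)}_{y,x}` is at most `(d+1)(L^K − 1)` (integers). [cite: Balaban1982Higgs1, (2.2) p.608] -/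
theorem length_gammaB_le {Mb : Fin (dd P + 1) → ℕ} (y : ↥(boxDom Mb)) (x : ↥(Box (dd P) (P.L - 1) K Mb)) :
    ((gammaB P K Mb y x).length : ℤ) ≤ ((dd P : ℤ) + 1) * ((P.L : ℤ) ^ K - 1) := by
  unfold gammaB
  split_ifs
  · rw [List.length_pmap]; exact length_mlist_le P.hL x.1 K
  · simp only [List.length_nil, Nat.cast_zero]
    have : (1 : ℤ) ≤ (P.L : ℤ) ^ K := by exact_mod_cast Nat.one_le_pow _ _ P.hL
    have : (0 : ℤ) ≤ dd P := Nat.cast_nonneg _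
    nlinarith

/-- The length of `Γ^{(K)}_{y,x}` is at most `(d+1)·n` (reals; the form used by r01's `lower18_regular_box`).
[cite: Balaban1982Higgs1, (2.2) p.608] -/
theorem length_gammaB_le_real {Mb : Fin (dd P + 1) → ℕ} (y : ↥(boxDom Mb)) (x : ↥(Box (dd P) (P.L - 1) K Mb)) :
    ((gammaB P K Mb y x).length : ℝ) ≤ ((dd P : ℝ) + 1) * ((((P.L - 1 + 1) ^ K : ℕ)) : ℝ) := by
  have h := length_gammaB_le (K := K) y x
  have h' : ((gammaB P K Mb y x).length : ℝ) ≤ ((dd P : ℝ) + 1) * ((P.L : ℝ) ^ K - 1) := by exact_mod_cast h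
  rw [predL_succ]
  push_cast
  have : (0 : ℝ) ≤ (dd P : ℝ) + 1 := by positivity
  nlinarith

/-- **`A(Γ^{(K)}_{y,x})` ON THE SUB-BOX IS B1's `multiContourSum` ALONG THE CHART** (times the scale `σ`), for any pair function whose
forward bond values on the sub-box are `σ·Ã`. [cite: Balaban1982Higgs1, (2.2)–(2.3) p.608] [cite: Balaban1983RegularityDecay, (1.4) p.572] -/
theorem lsum_gammaB (hK : K ≤ P.K) (hS : ∀ μ, P.L ^ K ≤ P.sitesPerDir 0 μ) (j : Lab P K K₀) {Mb : Fin (dd P + 1) → ℕ}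
    (At : HiggsLattice.VecField P 0) (σ : ℝ)
    (B : ↥(Box (dd P) (P.L - 1) K Mb) → ↥(Box (dd P) (P.L - 1) K Mb) → ℝ)
    (Bz : (Fin (dd P + 1) → ℤ) → (Fin (dd P + 1) → ℤ) → ℝ) (hBz : ∀ u v, B u v = Bz u.1 v.1)
    (hB : ∀ z ∈ Box (dd P) (P.L - 1) K Mb, ∀ i, Bz z (z + e1 i) = σ * At ⟨toT K K₀ j z, castD P i⟩)
    (y : ↥(boxDom Mb)) (x : ↥(Box (dd P) (P.L - 1) K Mb)) (h : blk (nK P K) x.1 = y.1) :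
    lsum B (baseEmb (one_le_n P K) Mb y) (gammaB P K Mb y x) = σ * multiContourSum At K (toT K K₀ j x.1) := by
  unfold gammaB
  rw [if_pos h, baseEmb_eq_mk h]
  have hfun : B = fun u v => Bz u.1 v.1 := by funext u v; exact hBz u v
  rw [hfun, lsum_pmap, lsum_mlist_eq_multiContourSum hK hS j At σ Bz x.1]
  intro z hz1 hz2 i
  refine hB z ?_ i
  have hx' := mem_boxDom.1 x.2
  refine mem_boxDom_of_between (u := clv P.L K x.1) ?_ x.2 hz1 hz2
  rw [mem_boxDom]
  exact fun i => ⟨clv_nonneg P.hL K (fun i => (hx' i).1) i, lt_of_le_of_lt (clv_le P.hL K x.1 i) (hx' i).2⟩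

end System

end Literature.MathematicalPhysics.QuantumFieldTheory.Balaban1983to89.B1TorusSubBoxChart
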